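import Summits.Ventures.LatticeQCDFlow.Exactness.Phi4FlowSymmetrisedSampler
import Literature.Analysis.SpecialFunctions.SelbergIntegralBasic
import HarnessLib

/-!
# The signed site symmetries of lattice φ⁴: `φ ↦ c·(φ ∘ σ⁻¹)` for a permutation `σ` preserving the couplings and a sign `c = ±1` — measure-preserving symmetries of `e^{−S}` forming a group action on `ℝ^Λ`

HONEST FRAMING: exact (Metropolis-corrected) sampling algorithms for lattice gauge theory;
figures of merit are autocorrelation/cost numbers at stated couplings and volumes; no
continuum-physics claim.  (SCALAR calibration rung S0-A: not a gauge result.)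

Venture `LatticeQCDFlow` (cell pub-lqcd), topic `Exactness`; FANOUT row 2 (`s0-phi4`).  NEW WORK of the
cell — the vocabulary gen-22 named as missing ('lattice instances beyond `Z₂` need symmetric
couplings'): for the tree's coupling-matrix action `S(φ) = Σ_{x,y} φ_x J_{xy} φ_y + λ Σ_x φ_x⁴` on
`ℝ^Λ`, `Λ = Fin (n+1)` (`Scoring.latticePhi4Action`, ANY real `J`), the natural symmetry group is
`{(σ, c) : σ ∈ Sym(Λ), J_{σ x, σ y} = J_{xy} ∀ x y, c = ±1}` acting by `(t_{(σ,c)} φ)_x = c·φ_{σ⁻¹ x}`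
— for the periodic nearest-neighbour couplings of the S0-A card these are the translations, rotations
and reflections of the torus times the global flip; for a general `J` whatever automorphisms `J` has.
This file types the action as measurable equivalences and proves the three facts the flow-arm files
(`FlowSamplerGroupSymmetrisation{,KL,Dirichlet,TauInt}`) take as hypotheses: Lebesgue measure is
preserved, `e^{−S}` is invariant, and `(σ, c) ↦ t_{(σ,c)}` is multiplicative.  Standard material (a
coordinate permutation preserves product Lebesgue measure: Mathlib's
`MeasureTheory.volume_measurePreserving_piCongrLeft`, the tree's `Selberg.piCongrLeft_perm_apply`; negation:
the tree's `measurePreserving_neg_pi`); no source is cited as a fact.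

## Contents

* `latticeSymm σ c : (Λ → ℝ) ≃ᵐ (Λ → ℝ)`, `(latticeSymm σ c φ) x = c·φ (σ⁻¹ x)` (`c : ℤˣ`);
* `measurePreserving_latticeSymm` — it preserves `volume`;
* `latticeSymm_mul` — `t_{(σσ', cc')} = t_{(σ,c)} ∘ t_{(σ',c')}`; `latticeSymm_hom_mul` — along a pair
  of homomorphisms `ρ : G →* Sym(Λ)`, `ε : G →* ℤˣ` the family `a ↦ t_{(ρ a, ε a)}` satisfies the
  group law `t_{ab} = t_a ∘ t_b` of the flow-arm files;
* `latticePhi4Action_latticeSymm`, **`gibbsWeight_latticeSymm`** — `J ∘ (σ × σ) = J` ⇒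
  `S(t_{(σ,c)} φ) = S(φ)` and `e^{−S}` is invariant (every `λ`, every sign);
* observables: `magnetisation_latticeSymm` (`M ∘ t_{(σ,c)} = c·M`: the magnetisation is in the SIGN
  sector), `sumSq_latticeSymm` (`Σ φ² ` invariant), `quarticSum_latticeSymm`, `quadForm_latticeSymm`
  (both parts of the action invariant).

NOT CLAIMED: which permutations are automorphisms of any particular card's `J` (an input); anything
about flows.  The sampler consequences are drawn in `Phi4FlowLatticeSymmetrisation`.
-/

namespace Summit.Ventures.LatticeQCDFlow.Exactness

open Real MeasureTheory Finset
open Summit.Ventures.LatticeQCDFlow.Scoring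

section Lattice

variable {n : ℕ}

/-- **The signed site symmetry `φ ↦ c·(φ ∘ σ⁻¹)` of `ℝ^Λ`** (`σ` a permutation of the sites,
`c = ±1`), as a measurable equivalence; its inverse is `φ ↦ c·(φ ∘ σ)`. -/
def latticeSymm (σ : Equiv.Perm (Fin (n + 1))) (c : ℤˣ) : (Fin (n + 1) → ℝ) ≃ᵐ (Fin (n + 1) → ℝ) where
  toFun φ x := ((c : ℤ) : ℝ) * φ (σ.symm x)
  invFun φ x := ((c : ℤ) : ℝ) * φ (σ x)
  left_inv φ := by
    funext x
    have hc : ((c : ℤ) : ℝ) * ((c : ℤ) : ℝ) = 1 := by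
      rw [← Int.cast_mul, Int.units_coe_mul_self, Int.cast_one]
    simp only [Equiv.symm_apply_apply]
    rw [← mul_assoc, hc, one_mul]
  right_inv φ := by
    funext x
    have hc : ((c : ℤ) : ℝ) * ((c : ℤ) : ℝ) = 1 := by
      rw [← Int.cast_mul, Int.units_coe_mul_self, Int.cast_one]
    simp only [Equiv.apply_symm_apply]
    rw [← mul_assoc, hc, one_mul]
  measurable_toFun := measurable_pi_lambda _ fun x => (measurable_pi_apply (σ.symm x)).const_mul _
  measurable_invFun := measurable_pi_lambda _ fun x => (measurable_pi_apply (σ x)).const_mul _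

/-- Pointwise form: `(latticeSymm σ c φ) x = c·φ (σ⁻¹ x)`. -/
theorem latticeSymm_apply (σ : Equiv.Perm (Fin (n + 1))) (c : ℤˣ) (φ : Fin (n + 1) → ℝ)
    (x : Fin (n + 1)) : latticeSymm σ c φ x = ((c : ℤ) : ℝ) * φ (σ.symm x) := rfl

/-- Mathlib's coordinate relabelling: `piCongrLeft (fun _ => ℝ) σ φ x = φ (σ⁻¹ x)`. -/
theorem piCongrLeft_apply_perm (σ : Equiv.Perm (Fin (n + 1))) (φ : Fin (n + 1) → ℝ) (x : Fin (n + 1)) :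
    MeasurableEquiv.piCongrLeft (fun _ : Fin (n + 1) => ℝ) σ φ x = φ (σ.symm x) := by
  have h := Literature.Analysis.SpecialFunctions.Selberg.piCongrLeft_perm_apply σ.symm φ x
  simpa only [Equiv.symm_symm] using h

/-- **`latticeSymm σ c` preserves Lebesgue measure on `ℝ^Λ`** (a coordinate permutation does, and so
does the global flip). -/
theorem measurePreserving_latticeSymm (σ : Equiv.Perm (Fin (n + 1))) (c : ℤˣ) :
    MeasurePreserving (latticeSymm σ c) volume volume := by
  have hperm : MeasurePreserving (MeasurableEquiv.piCongrLeft (fun _ : Fin (n + 1) => ℝ) σ)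
      volume volume := volume_measurePreserving_piCongrLeft (fun _ : Fin (n + 1) => ℝ) σ
  rcases Int.units_eq_one_or c with hc | hc
  · have e : (latticeSymm σ c : (Fin (n + 1) → ℝ) → (Fin (n + 1) → ℝ))
        = MeasurableEquiv.piCongrLeft (fun _ : Fin (n + 1) => ℝ) σ := by
      funext φ x
      rw [latticeSymm_apply, piCongrLeft_apply_perm, hc, Units.val_one, Int.cast_one, one_mul]
    rw [e]
    exact hperm
  · have e : (latticeSymm σ c : (Fin (n + 1) → ℝ) → (Fin (n + 1) → ℝ))
        = (fun φ : Fin (n + 1) → ℝ => -φ) ∘ MeasurableEquiv.piCongrLeft (fun _ : Fin (n + 1) => ℝ) σ := by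
      funext φ x
      rw [latticeSymm_apply, Function.comp_apply, Pi.neg_apply, piCongrLeft_apply_perm, hc,
        Units.val_neg, Units.val_one, Int.cast_neg, Int.cast_one, neg_one_mul]
    rw [e]
    exact measurePreserving_neg_pi.comp hperm

/-- Inverse of a product of permutations, pointwise: `(σ σ')⁻¹ x = σ'⁻¹ (σ⁻¹ x)`. -/
theorem perm_mul_symm_apply (σ σ' : Equiv.Perm (Fin (n + 1))) (x : Fin (n + 1)) :
    (σ * σ').symm x = σ'.symm (σ.symm x) := by
  rw [Equiv.symm_apply_eq, Equiv.Perm.mul_apply, Equiv.apply_symm_apply, Equiv.apply_symm_apply]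

/-- **Multiplicativity**: `latticeSymm (σ σ') (c c') = latticeSymm σ c ∘ latticeSymm σ' c'`. -/
theorem latticeSymm_mul (σ σ' : Equiv.Perm (Fin (n + 1))) (c c' : ℤˣ) (φ : Fin (n + 1) → ℝ) :
    latticeSymm (σ * σ') (c * c') φ = latticeSymm σ c (latticeSymm σ' c' φ) := by
  funext x
  simp only [latticeSymm_apply]
  rw [perm_mul_symm_apply, Units.val_mul, Int.cast_mul]
  ring

/-- **The group law of the flow-arm files** along homomorphisms `ρ : G →* Sym(Λ)`, `ε : G →* ℤˣ`:
`t_{ab} = t_a ∘ t_b` for `t_a = latticeSymm (ρ a) (ε a)`. -/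
theorem latticeSymm_hom_mul {G : Type*} [Group G] (ρ : G →* Equiv.Perm (Fin (n + 1))) (ε : G →* ℤˣ)
    (a b : G) (φ : Fin (n + 1) → ℝ) :
    latticeSymm (ρ (a * b)) (ε (a * b)) φ = latticeSymm (ρ a) (ε a) (latticeSymm (ρ b) (ε b) φ) := by
  rw [map_mul, map_mul, latticeSymm_mul]

/-! ## Invariance of the action and of the Gibbs weight -/

/-- A `J`-automorphism is also one for `σ⁻¹`: `J (σ⁻¹ x) (σ⁻¹ y) = J x y`. -/
theorem couplings_symm_of_couplings_perm {J : Fin (n + 1) → Fin (n + 1) → ℝ}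
    {σ : Equiv.Perm (Fin (n + 1))} (hJ : ∀ x y, J (σ x) (σ y) = J x y) (x y : Fin (n + 1)) :
    J (σ.symm x) (σ.symm y) = J x y := by
  have h := hJ (σ.symm x) (σ.symm y)
  rw [Equiv.apply_symm_apply, Equiv.apply_symm_apply] at h
  exact h.symm

/-- The quartic part is invariant: `Σ_x (t φ)_x⁴ = Σ_x φ_x⁴`. -/
theorem quarticSum_latticeSymm (σ : Equiv.Perm (Fin (n + 1))) (c : ℤˣ) (φ : Fin (n + 1) → ℝ) :
    ∑ x, latticeSymm σ c φ x ^ 4 = ∑ x, φ x ^ 4 := by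
  simp only [latticeSymm_apply]
  have hc4 : ((c : ℤ) : ℝ) ^ 4 = 1 := by
    have hc : ((c : ℤ) : ℝ) ^ 2 = 1 := by rw [sq, ← Int.cast_mul, Int.units_coe_mul_self, Int.cast_one]
    rw [show (4 : ℕ) = 2 * 2 from rfl, pow_mul, hc, one_pow]
  have e : ∀ x, (((c : ℤ) : ℝ) * φ (σ.symm x)) ^ 4 = φ (σ.symm x) ^ 4 := fun x => by
    rw [mul_pow, hc4, one_mul]
  simp only [e]
  exact Equiv.sum_comp σ.symm (fun x => φ x ^ 4)

/-- The quadratic form is invariant under a `J`-automorphism: `Σ (tφ)_x J_{xy} (tφ)_y = Σ φ_x J_{xy} φ_y`. -/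
theorem quadForm_latticeSymm {J : Fin (n + 1) → Fin (n + 1) → ℝ} {σ : Equiv.Perm (Fin (n + 1))}
    (hJ : ∀ x y, J (σ x) (σ y) = J x y) (c : ℤˣ) (φ : Fin (n + 1) → ℝ) :
    ∑ x, ∑ y, latticeSymm σ c φ x * J x y * latticeSymm σ c φ y = ∑ x, ∑ y, φ x * J x y * φ y := by
  simp only [latticeSymm_apply]
  have e : ∀ x y, ((c : ℤ) : ℝ) * φ (σ.symm x) * J x y * (((c : ℤ) : ℝ) * φ (σ.symm y))
      = φ (σ.symm x) * J (σ.symm x) (σ.symm y) * φ (σ.symm y) := fun x y => by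
    rw [couplings_symm_of_couplings_perm hJ]
    have h : ((c : ℤ) : ℝ) * ((c : ℤ) : ℝ) = 1 := by
      rw [← Int.cast_mul, Int.units_coe_mul_self, Int.cast_one]
    calc ((c : ℤ) : ℝ) * φ (σ.symm x) * J x y * (((c : ℤ) : ℝ) * φ (σ.symm y))
        = (((c : ℤ) : ℝ) * ((c : ℤ) : ℝ)) * (φ (σ.symm x) * J x y * φ (σ.symm y)) := by ring
      _ = φ (σ.symm x) * J x y * φ (σ.symm y) := by rw [h, one_mul]
  simp only [e]
  calc ∑ x, ∑ y, φ (σ.symm x) * J (σ.symm x) (σ.symm y) * φ (σ.symm y)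
      = ∑ x, ∑ y, φ (σ.symm x) * J (σ.symm x) y * φ y :=
        Finset.sum_congr rfl fun x _ =>
          Equiv.sum_comp σ.symm (fun y => φ (σ.symm x) * J (σ.symm x) y * φ y)
    _ = ∑ x, ∑ y, φ x * J x y * φ y := Equiv.sum_comp σ.symm (fun x => ∑ y, φ x * J x y * φ y)

/-- **`S(t_{(σ,c)} φ) = S(φ)`** for every `J`-automorphism `σ`, every sign, every `λ`. -/
theorem latticePhi4Action_latticeSymm {J : Fin (n + 1) → Fin (n + 1) → ℝ}
    {σ : Equiv.Perm (Fin (n + 1))} (hJ : ∀ x y, J (σ x) (σ y) = J x y) (c : ℤˣ) (lam : ℝ)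
    (φ : Fin (n + 1) → ℝ) :
    latticePhi4Action J lam (latticeSymm σ c φ) = latticePhi4Action J lam φ := by
  unfold latticePhi4Action
  rw [quadForm_latticeSymm hJ, quarticSum_latticeSymm]

/-- **THE GIBBS WEIGHT IS INVARIANT: `e^{−S(t_{(σ,c)} φ)} = e^{−S(φ)}`** (`J ∘ (σ×σ) = J`). -/
theorem gibbsWeight_latticeSymm {J : Fin (n + 1) → Fin (n + 1) → ℝ} {σ : Equiv.Perm (Fin (n + 1))}
    (hJ : ∀ x y, J (σ x) (σ y) = J x y) (c : ℤˣ) (lam : ℝ) (φ : Fin (n + 1) → ℝ) :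
    gibbsWeight J lam (latticeSymm σ c φ) = gibbsWeight J lam φ := by
  unfold gibbsWeight
  rw [latticePhi4Action_latticeSymm hJ]

/-! ## How the observables of record transform -/

/-- **The magnetisation is in the sign sector: `M(t_{(σ,c)} φ) = c·M(φ)`.** -/
theorem magnetisation_latticeSymm (σ : Equiv.Perm (Fin (n + 1))) (c : ℤˣ) (φ : Fin (n + 1) → ℝ) :
    ∑ x, latticeSymm σ c φ x = ((c : ℤ) : ℝ) * ∑ x, φ x := by
  simp only [latticeSymm_apply]
  rw [← Finset.mul_sum, Equiv.sum_comp σ.symm (fun x => φ x)]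

/-- `Σ_x φ_x²` is invariant. -/
theorem sumSq_latticeSymm (σ : Equiv.Perm (Fin (n + 1))) (c : ℤˣ) (φ : Fin (n + 1) → ℝ) :
    ∑ x, latticeSymm σ c φ x ^ 2 = ∑ x, φ x ^ 2 := by
  simp only [latticeSymm_apply]
  have e : ∀ x, (((c : ℤ) : ℝ) * φ (σ.symm x)) ^ 2 = φ (σ.symm x) ^ 2 := fun x => by
    have hc : ((c : ℤ) : ℝ) ^ 2 = 1 := by rw [sq, ← Int.cast_mul, Int.units_coe_mul_self, Int.cast_one]
    rw [mul_pow, hc, one_mul]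
  simp only [e]
  exact Equiv.sum_comp σ.symm (fun x => φ x ^ 2)

/-- `M²` is invariant. -/
theorem magnetisationSq_latticeSymm (σ : Equiv.Perm (Fin (n + 1))) (c : ℤˣ) (φ : Fin (n + 1) → ℝ) :
    (∑ x, latticeSymm σ c φ x) ^ 2 = (∑ x, φ x) ^ 2 := by
  have hc : ((c : ℤ) : ℝ) ^ 2 = 1 := by rw [sq, ← Int.cast_mul, Int.units_coe_mul_self, Int.cast_one]
  rw [magnetisation_latticeSymm, mul_pow, hc, one_mul]

end Lattice

end Summit.Ventures.LatticeQCDFlow.Exactness
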